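import Mathlib
import HarnessLib
import Summits.HubbardSuperconductivity.HubbardSuperconductivity.Theorems.KLProgrammeKLRegimeTwoVolumeSrcTowerIdentity
import Summits.HubbardSuperconductivity.HubbardSuperconductivity.Theorems.KLProgrammeKLRegimeTwoVolumeSourceProfileDefsF

/-!
# Route `KLProgramme` — crux K3, VL child `KLRegimeVolumeLimitV17F3` (stmt-HubbardSuperconductivity-23356), producer route «(VL)-SRC-SOFT» §S1 at a
# GENERIC SOURCE FAMILY (cure of LR13′ «(VL)-HUV-CURRENCY-PROPAGATION», step F1; seat hubbard-kl-k3c4-p1 g20; `--supports` 23356)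

Twin of `…TwoVolumeSrcBlockIdentity.klSrcBlock_eq_map_doubleBlock_effAction` (p668045) with the source copy analysed by an arbitrary one-sector family
`F` (`…TwoVolumeSourceProfileDefsF.klSrcAnalysisAtF`):

  `map (toLin' (ε • klSrcAnalysisAtF … F J′)) 𝒱_{J₂}[K] = map (toLin' T⁺) (effAction C⁺ (klTowerDF … F (J₁ − 1)))`,   `1 ≤ J₁ ≤ J₂`, `J₁ ≤ J′`,

with the SAME block covariance `C⁺` (the spectator lift of `S(F̃_{J₁−1})ᵀ C^K_{(Λ_{J₂},Λ_{J₁}]} S(F̃_{J₁−1})`, zero on the source copy) and the SAME transfer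
`T⁺ = (ε•E(F_{J′})·S(F̃_{J₁−1})) ⊕ J` (`J` the slot-`0` identity) as the plain identity: the source block enters only through
`…SrcTowerIdentity.srcSlotShift_mul_srcPlain`, which is generic in it.  This is the tree form of fact (2) of the LR13′ memo: the blocked source tower is
blind to the source family.

* **`klSrcBlockF_eq_map_doubleBlock_effAction`** — the displayed identity.

Proof only (instance of `map_doubleRows_effAction_eq_map_doubleBlock_effAction`, p569473); no definition; nothing about sizes is asserted.
References: BGM 2006 §2.7 (2.70)–(2.71), §2.9 (4.3)–(4.6).
-/

noncomputable section

namespace Summit.HubbardSuperconductivity.HubbardSuperconductivity.Theorems.TwoVolumeDefect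

set_option linter.dupNamespace false -- summit = problem name (single-conjunct summit), D-0017

open Finset Literature.MathematicalPhysics.QuantumLattice GrassmannAlgebra Literature.Probability.LatticeModels
open Summit.HubbardSuperconductivity.HubbardSuperconductivity.Theorems.KLProgrammeLegKernels
open Summit.HubbardSuperconductivity.HubbardSuperconductivity.Theorems.KLRegimeSplit
open Summit.HubbardSuperconductivity.HubbardSuperconductivity.Theorems.EngineV8
open Summit.HubbardSuperconductivity.HubbardSuperconductivity.Theorems.TwoVolumeSource

variable {L M : ℕ} [NeZero L] [NeZero M]

/-- **THE SOURCE-CARRYING ACTION ACROSS A BLOCK, GENERIC SOURCE FAMILY `F`: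
`map (toLin' (ε • klSrcAnalysisAtF … F J′)) 𝒱_{J₂} = map (toLin' T⁺) (effAction C⁺ (klTowerDF … F (J₁−1)))`**, `1 ≤ J₁ ≤ J₂`, `J₁ ≤ J′`, with `C⁺` the
spectator lift of `S(F̃_{J₁−1})ᵀ C^K_{(Λ_{J₂},Λ_{J₁}]} S(F̃_{J₁−1})` (zero on the source copy), `T⁺ = (ε•E(F_{J′})·S(F̃_{J₁−1})) ⊕ J` (`J` the slot-`0`
identity); needs `Z^K_{Λ_{J₁}} ≠ 0`, `β ≠ 0`. [cite: BenfattoGiulianiMastropietro2006, §2.7 (2.70)-(2.71)] -/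
theorem klSrcBlockF_eq_map_doubleBlock_effAction {β : ℝ} (hβ : β ≠ 0) (U μ : ℝ) (K : TrigPolyC4v) (F : Fin 1 → FreqMomentum L M → ℂ)
    {J₁ J₂ J' : ℕ} (hJ₁ : 1 ≤ J₁) (hJ : J₁ ≤ J₂) (hJ' : J₁ ≤ J')
    (hZ : hubbardEffPartitionFnCT L M β U μ 0 K (klScale klE0 J₁) ≠ 0)
    (C' : Matrix (SrcLabel L M (J₁ - 1)) (SrcLabel L M (J₁ - 1)) ℂ)
    (hC' : ∀ p q, C' p q = if p.2 = 0 ∧ q.2 = 0 then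
      ((sectorSubMatrix L M β (bgmFatMultiplier L M klE0 β (nambuXiCT L μ K) (J₁ - 1))).transpose *
          hubbardCovSliceCT L M β μ 0 K (klScale klE0 J₂) (klScale klE0 J₁) *
        sectorSubMatrix L M β (bgmFatMultiplier L M klE0 β (nambuXiCT L μ K) (J₁ - 1))) p.1 q.1 else 0)
    (Jm : Matrix (SpaceTimeIdx L M × SectorLeg (sectorCount J')) (SpaceTimeIdx L M × SectorLeg (sectorCount (J₁ - 1))) ℂ)
    (hJm : ∀ Y' Y, Jm Y' Y = if Y'.1 = Y.1 ∧ (Y'.2.1.1 : ℕ) = 0 ∧ (Y.2.1.1 : ℕ) = 0 ∧ Y'.2.1.2 = Y.2.1.2 ∧ Y'.2.2 = Y.2.2 then 1 else 0)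
    (Tp : Matrix (SrcLabel L M J') (SrcLabel L M (J₁ - 1)) ℂ)
    (hTp : ∀ p' p, Tp p' p = if p'.2 = 0 ∧ p.2 = 0 then
      ((((imagTimeWeight β M : ℝ) : ℂ) • sectorAnalysisMatrix L M β (klAnisoFamily L M β μ K klE0 J')) *
        sectorSubMatrix L M β (bgmFatMultiplier L M klE0 β (nambuXiCT L μ K) (J₁ - 1))) p'.1 p.1
      else if p'.2 = 1 ∧ p.2 = 1 then Jm p'.1 p.1 else 0) :
    ExteriorAlgebra.map (Matrix.toLin' ((((imagTimeWeight β M : ℝ) : ℂ)) • klSrcAnalysisAtF L M β μ K F J'))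
        (klEffectiveAction L M β U μ K klE0 J₂) =
      ExteriorAlgebra.map (Matrix.toLin' Tp) (effAction ℂ C' (klTowerDF L M β U μ K F (J₁ - 1))) := by
  have he : (0 : ℝ) < klE0 := by norm_num [klE0]
  have hJ₁' : J₁ - 1 + 1 = J₁ := Nat.sub_add_cancel hJ₁
  rw [klTowerDF_def, hJ₁']
  -- the block `𝒱_{J₁} → 𝒱_{J₂}` integrates `C^K_{(Λ_{J₂}, Λ_{J₁}]}`
  rw [klEffectiveAction_eq_effAction_slice β U μ K klE0 J₂ J₁ hZ]
  -- the source blocks at the two sector counts, related by the slot-`0` identity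
  set b : SpaceTimeIdx L M → Fin 2 → Fin 2 → HubbardFieldIdx L M → ℂ := fun x σ c X =>
    (((imagTimeWeight β M : ℝ) : ℂ)) * sectorAnalysisMatrix L M β F (x, (((0 : Fin 1), σ), c)) X with hb
  set B : Matrix (SpaceTimeIdx L M × SectorLeg (sectorCount (J₁ - 1))) (HubbardFieldIdx L M) ℂ :=
    Matrix.of fun Y X => if (Y.2.1.1 : ℕ) = 0 then b Y.1 Y.2.1.2 Y.2.2 X else 0 with hBdef
  set B' : Matrix (SpaceTimeIdx L M × SectorLeg (sectorCount J')) (HubbardFieldIdx L M) ℂ :=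
    Matrix.of fun Y X => if (Y.2.1.1 : ℕ) = 0 then b Y.1 Y.2.1.2 Y.2.2 X else 0 with hB'def
  have hBB : Jm * B = B' :=
    srcSlotShift_mul_srcPlain (sectorCount_pos (J₁ - 1)) b B (fun _ _ => rfl) B' (fun _ _ => rfl) Jm hJm
  -- the doubled rows at the two families
  have hMx : ∀ p X, ((((imagTimeWeight β M : ℝ) : ℂ)) • klSrcAnalysisAtF L M β μ K F (J₁ - 1)) p X =
      if p.2 = 0 then ((((imagTimeWeight β M : ℝ) : ℂ)) • sectorAnalysisMatrix L M β (klAnisoFamily L M β μ K klE0 (J₁ - 1))) p.1 X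
      else B p.1 X := by
    intro p X; rw [klSrcAnalysisAtF_smul_apply]; rfl
  have hMx' : ∀ p' X, ((((imagTimeWeight β M : ℝ) : ℂ)) • klSrcAnalysisAtF L M β μ K F J') p' X =
      if p'.2 = 0 then ((((imagTimeWeight β M : ℝ) : ℂ)) • sectorAnalysisMatrix L M β (klAnisoFamily L M β μ K klE0 J')) p'.1 X
      else B' p'.1 X := by
    intro p' X; rw [klSrcAnalysisAtF_smul_apply]; rfl
  -- the engine's plateau facts at the block geometry: fat × thin = thin; `F_{J′}` and the block covariance live inside the plateau of `F_{J₁−1}`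
  have hFF : ∀ ω p, bgmFatMultiplier L M klE0 β (nambuXiCT L μ K) (J₁ - 1) ω p * klAnisoFamily L M β μ K klE0 (J₁ - 1) ω p =
      klAnisoFamily L M β μ K klE0 (J₁ - 1) ω p :=
    fun ω p => bgmFatMultiplier_mul_bgmMultiplier he β (nambuXiCT L μ K) (J₁ - 1) ω p
  have hF'pl : ∀ (ω' : Fin (sectorCount J')) (p : FreqMomentum L M), klAnisoFamily L M β μ K klE0 J' ω' p ≠ 0 →
      ∑ ω, klAnisoFamily L M β μ K klE0 (J₁ - 1) ω p = 1 :=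
    fun ω' p h => sum_klAnisoFamily_pred_eq_one_of_klAnisoFamily_ne_zero β μ K hJ₁ hJ' ω' p h
  have hCpl : ∀ X Y : HubbardFieldIdx L M, hubbardCovSliceCT L M β μ 0 K (klScale klE0 J₂) (klScale klE0 J₁) X Y ≠ 0 →
      ∑ ω, klAnisoFamily L M β μ K klE0 (J₁ - 1) ω X.1.1 = 1 ∧ ∑ ω, klAnisoFamily L M β μ K klE0 (J₁ - 1) ω Y.1.1 = 1 :=
    fun X Y h => sum_klAnisoFamily_eq_one_of_blockSliceCT_ne_zero (L := L) (M := M) β μ K hJ₁ hJ X Y h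
  exact map_doubleRows_effAction_eq_map_doubleBlock_effAction hβ _ _ hFF _ hF'pl _ hCpl C' hC' B B' Jm hBB Tp hTp _ hMx _ hMx' _

end Summit.HubbardSuperconductivity.HubbardSuperconductivity.Theorems.TwoVolumeDefect

end
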